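import Mathlib
import Literature.NumberTheory.Transcendental.KZProductIdeal
import Literature.NumberTheory.Transcendental.KZRulesAssociator
import Literature.NumberTheory.Transcendental.KZCalculusOver
import Summits.KontsevichZagierPeriods.KontsevichZagierPeriods.Theorems.SoloInformedProductOver
import Summits.KontsevichZagierPeriods.KontsevichZagierPeriods.Theorems.SoloInformedProductIdealOver
import HarnessLib

/-!
# The Fubini product of `KZ_k` is commutative, associative and unital modulo relations

File of the solo-informed residency (s235), sequel of `SoloInformedProductOver` (the product) and
`SoloInformedProductIdealOver` (`relations k` is a left ideal).  Over every coefficient ring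
`k → ℝ`:

* `soloInformedReindexOver r e` — relabelling coordinates along `e : Fin n ≃ Fin n'`;
  **`soloInformed_ofOver_sub_ofOver_reindex_mem_relations`** — it is a change-of-variables move
  (`|det| = 1`, a permutation matrix).
* `soloInformed_prodOver_eq_reindex_prodOver` — `[σ, f] × [τ, g]` IS the block flip of
  `[τ, g] × [σ, f]`; hence **`soloInformed_mul_sub_mul_comm_mem_relationsOver`**:
  `c * d − d * c ∈ relations k`; **`soloInformed_mul_mem_relationsOver_right`** (right ideal),
  **`soloInformed_mul_sub_mul_mem_relationsOver`** (two-sided: `*` descends to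
  `FormalRep k ⧸ relations k`), `soloInformed_equivalentOver_prod`.
* `soloInformedUnitOver : KZOver.IntegralRep k 0` — `[pt, 1]`, value `1`;
  `soloInformed_ofUnitOver_mul_sub_mem_relations`, `soloInformed_mul_ofUnitOver_sub_mem_relations`
  (unit laws modulo relations); `soloInformed_mul_assoc_sub_mem_relationsOver` (associativity
  modulo relations, via `soloInformed_prodOver_prodOver_eq_reindex`).

Coefficient-generic forms of `KZ.of_sub_of_reindex_mem_relations`,
`KZ.mul_sub_mul_comm_mem_relations`, `KZ.mul_mem_relations_right_holds` (`KZProductIdeal.lean`)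
and of `KZ.of_unit_mul_sub_mem_relations`, `KZ.mul_assoc_sub_mem_relations`
(`KZRulesAssociator.lean`), all for `k = ℚ`, whose proofs are followed.  The commutative ring
`FormalRep k ⧸ relations k` is assembled in the sequel.  Bearing: residency verdict,
`paper/real-parameters.md` (S1), kernel form; nothing here bears on Conjecture 1.

References: M. Kontsevich, D. Zagier, *Periods* (2001), §1.2 rule (2), §4.1 (p. 31); J. Bochnak,
M. Coste, M.-F. Roy, *Real Algebraic Geometry* (1998), §2.2.
-/

noncomputable section

open Set MeasureTheory MvPolynomial
open Literature.ModelTheory.ExponentialFields Literature.NumberTheory.Transcendental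

namespace Summit.KontsevichZagierPeriods.KontsevichZagierPeriods.Theorems

variable {k : Type*} [CommRing k] [Algebra k ℝ] {n m l n' : ℕ}

/-! ### Reindexing coordinates is a move -/

/-- **Reindexing coordinates** along `e : Fin n ≃ Fin n'`: domain `{w | (w ∘ e) ∈ σ}`, integrand
`w ↦ f (w ∘ e)` (coordinate preimages; `w ↦ w ∘ e` preserves Lebesgue measure). -/
def soloInformedReindexOver (r : KZOver.IntegralRep k n) (e : Fin n ≃ Fin n') :
    KZOver.IntegralRep k n' where
  domain := {w | (fun i => w (e i)) ∈ r.domain}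
  integrand := fun w => r.integrand (fun i => w (e i))
  isSemialgebraic_domain := r.isSemialgebraic_domain.preimage_comp e
  isSemialgebraicFunOn_integrand := by
    rw [isSemialgebraicFunOn_iff]
    let ρ : Fin (n + 1) → Fin (n' + 1) := Fin.lastCases (Fin.last n') fun i => Fin.castSucc (e i)
    have hΓ := (isSemialgebraicFunOn_iff.mp r.isSemialgebraicFunOn_integrand).preimage_comp ρ
    convert hΓ using 1
    have hinit : ∀ w : Fin (n' + 1) → ℝ, Fin.init (w ∘ ρ) = fun i => Fin.init w (e i) := by
      intro w; ext i; simp [Fin.init, ρ]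
    have hlast : ∀ w : Fin (n' + 1) → ℝ, (w ∘ ρ) (Fin.last n) = w (Fin.last n') := by
      intro w; simp [ρ]
    ext w
    simp only [mem_setOf_eq, mem_preimage, hinit, hlast]
  integrableOn := by
    have hmp : MeasurePreserving (MeasurableEquiv.piCongrLeft (fun _ : Fin n => ℝ) e.symm)
        (volume : Measure (Fin n' → ℝ)) (volume : Measure (Fin n → ℝ)) :=
      volume_measurePreserving_piCongrLeft (fun _ : Fin n => ℝ) e.symm
    have happ : ∀ w : Fin n' → ℝ,
        MeasurableEquiv.piCongrLeft (fun _ : Fin n => ℝ) e.symm w = fun i => w (e i) := by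
      intro w; ext i
      simpa using MeasurableEquiv.piCongrLeft_apply_apply e.symm (β := fun _ : Fin n => ℝ) w (e i)
    have h := (hmp.integrableOn_comp_preimage (MeasurableEquiv.piCongrLeft (fun _ : Fin n => ℝ)
      e.symm).measurableEmbedding).mpr r.integrableOn
    have hfun : (fun w : Fin n' → ℝ => r.integrand fun i => w (e i)) =
        r.integrand ∘ (MeasurableEquiv.piCongrLeft (fun _ : Fin n => ℝ) e.symm) := by
      ext w; rw [Function.comp_apply, happ]
    have hset : {w : Fin n' → ℝ | (fun i => w (e i)) ∈ r.domain} =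
        (MeasurableEquiv.piCongrLeft (fun _ : Fin n => ℝ) e.symm) ⁻¹' r.domain := by
      ext w; rw [mem_preimage, happ, mem_setOf_eq]
    rw [hfun, hset]
    exact h

/-- The domain of a reindexed representation. -/
@[simp] theorem soloInformed_reindexOver_domain (r : KZOver.IntegralRep k n) (e : Fin n ≃ Fin n') :
    (soloInformedReindexOver r e).domain = {w | (fun i => w (e i)) ∈ r.domain} := rfl

/-- The integrand of a reindexed representation. -/
@[simp] theorem soloInformed_reindexOver_integrand (r : KZOver.IntegralRep k n) (e : Fin n ≃ Fin n') :
    (soloInformedReindexOver r e).integrand = fun w => r.integrand (fun i => w (e i)) := rfl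

/-- **Reindexing coordinates is a change-of-variables move**: `[r] − [r.reindex e] ∈ relations k`.
`e : Fin n ≃ Fin n'` forces `n' = n`; `Φ z = z ∘ e⁻¹` is a coordinate permutation (a
`k`-polynomial map, its own derivative, injective, `|det| = 1`). -/
theorem soloInformed_ofOver_sub_ofOver_reindex_mem_relations (r : KZOver.IntegralRep k n)
    (e : Fin n ≃ Fin n') :
    KZOver.of r - KZOver.of (soloInformedReindexOver r e) ∈ KZOver.relations k := by
  obtain rfl : n = n' := by simpa using Fintype.card_congr e
  let M : Matrix (Fin n) (Fin n) ℝ := (1 : Matrix (Fin n) (Fin n) ℝ).submatrix e.symm (Equiv.refl _)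
  let L : (Fin n → ℝ) →L[ℝ] (Fin n → ℝ) := LinearMap.toContinuousLinearMap (Matrix.toLin' M)
  have hL : ∀ z : Fin n → ℝ, L z = fun j => z (e.symm j) := by
    intro z
    change Matrix.toLin' M z = _
    rw [Matrix.toLin'_apply, Matrix.submatrix_mulVec_equiv, Matrix.one_mulVec]
    rfl
  have hdet : |L.det| = 1 := by
    change |LinearMap.det (Matrix.toLin' M)| = 1
    rw [LinearMap.det_toLin', Matrix.abs_det_submatrix_equiv_equiv, Matrix.det_one, abs_one]
  refine KZOver.changeOfVariablesRel_subset_relations ⟨n, r, soloInformedReindexOver r e,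
    fun z => fun j => z (e.symm j), fun _ => L, ?_, ?_, ?_, ?_, ?_, rfl⟩
  · convert isSemialgebraicMapOn_aeval r.isSemialgebraic_domain
      (fun j => (X (e.symm j) : MvPolynomial (Fin n) k)) using 2 with z
    ext j; simp
  · intro z _
    have h := L.hasFDerivWithinAt (s := r.domain) (x := z)
    convert h using 1
    ext z' j
    rw [hL]
  · intro z₁ _ z₂ _ h
    ext i
    have := congrFun h (e i)
    simpa using this
  · ext w
    simp only [soloInformed_reindexOver_domain, mem_setOf_eq, mem_image]
    constructor
    · intro hw
      exact ⟨fun i => w (e i), hw, by ext j; simp⟩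
    · rintro ⟨z, hz, rfl⟩
      simpa using hz
  · intro z _
    rw [hdet, mul_one, soloInformed_reindexOver_integrand]
    simp

/-! ### Commutativity modulo relations; right and two-sided ideal -/

section Comm

variable (r : KZOver.IntegralRep k n) (s : KZOver.IntegralRep k m)

/-- **`[σ, f] × [τ, g]` is the block flip of `[τ, g] × [σ, f]`** along
`finAddFlip : Fin (m + n) ≃ Fin (n + m)`, as integral representations. -/
theorem soloInformed_prodOver_eq_reindex_prodOver :
    soloInformedProdOver r s = soloInformedReindexOver (soloInformedProdOver s r) finAddFlip := by
  refine KZOver.IntegralRep.ext ?_ ?_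
  · ext z
    simp only [soloInformed_prodOver_domain, soloInformed_mem_prodDomainOver,
      soloInformed_reindexOver_domain, mem_setOf_eq, finAddFlip_apply_castAdd,
      finAddFlip_apply_natAdd]
    exact and_comm
  · funext z
    simp only [soloInformed_prodOver_integrand, soloInformed_prodFunOver_apply,
      soloInformed_reindexOver_integrand, finAddFlip_apply_castAdd, finAddFlip_apply_natAdd]
    exact mul_comm _ _

/-- **`*` is commutative modulo relations, on generators**: `[r] * [s] − [s] * [r] ∈ relations k`. -/
theorem soloInformed_ofOver_mul_ofOver_comm_mem_relations :
    KZOver.of r * KZOver.of s - KZOver.of s * KZOver.of r ∈ KZOver.relations k := by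
  rw [soloInformed_ofOver_mul_ofOver, soloInformed_ofOver_mul_ofOver,
    soloInformed_prodOver_eq_reindex_prodOver r s, ← neg_sub]
  exact (KZOver.relations k).neg_mem (soloInformed_ofOver_sub_ofOver_reindex_mem_relations _ _)

end Comm

/-- The values of an additive map `FormalRep k →+ FormalRep k` lie in `relations k` as soon as its
values on generators do. -/
theorem soloInformed_map_mem_relationsOver_of_forall_of (f : KZOver.FormalRep k →+ KZOver.FormalRep k)
    (h : ∀ (n : ℕ) (r : KZOver.IntegralRep k n), f (KZOver.of r) ∈ KZOver.relations k)
    (x : KZOver.FormalRep k) : f x ∈ KZOver.relations k := by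
  induction x using FreeAbelianGroup.induction_on with
  | zero => rw [map_zero]; exact (KZOver.relations k).zero_mem
  | of X => obtain ⟨n, r⟩ := X; exact h n r
  | neg X ih => rw [map_neg]; exact (KZOver.relations k).neg_mem ih
  | add X Y hX hY => rw [map_add]; exact (KZOver.relations k).add_mem hX hY

/-- **`*` is commutative modulo relations**: `c * d − d * c ∈ relations k` (the defect is additive
in each variable; generator case `soloInformed_ofOver_mul_ofOver_comm_mem_relations`). -/
theorem soloInformed_mul_sub_mul_comm_mem_relationsOver (c d : KZOver.FormalRep k) :
    c * d - d * c ∈ KZOver.relations k := by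
  refine soloInformed_map_mem_relationsOver_of_forall_of
    (AddMonoidHom.mulRight d - AddMonoidHom.mulLeft d) (fun n r => ?_) c
  change KZOver.of r * d - d * KZOver.of r ∈ KZOver.relations k
  refine soloInformed_map_mem_relationsOver_of_forall_of
    (AddMonoidHom.mulLeft (KZOver.of r) - AddMonoidHom.mulRight (KZOver.of r)) (fun m s => ?_) d
  exact soloInformed_ofOver_mul_ofOver_comm_mem_relations r s

/-- **`relations k` is a right ideal**: `c ∈ relations k → c * c' ∈ relations k`
(`c * c' = (c * c' − c' * c) + c' * c` and the left-ideal property). -/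
theorem soloInformed_mul_mem_relationsOver_right (c' : KZOver.FormalRep k) {c : KZOver.FormalRep k}
    (hc : c ∈ KZOver.relations k) : c * c' ∈ KZOver.relations k := by
  have h := (KZOver.relations k).add_mem (soloInformed_mul_sub_mul_comm_mem_relationsOver c c')
    (soloInformed_mul_mem_relationsOver_left c' hc)
  simpa using h

/-- **`relations k` is a two-sided ideal**: equivalent factors have equivalent products,
`c₁ − c₂ ∈ relations k → d₁ − d₂ ∈ relations k → c₁ * d₁ − c₂ * d₂ ∈ relations k`, i.e. `*`
descends to `FormalRep k ⧸ relations k`. -/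
theorem soloInformed_mul_sub_mul_mem_relationsOver {c₁ c₂ d₁ d₂ : KZOver.FormalRep k}
    (hc : c₁ - c₂ ∈ KZOver.relations k) (hd : d₁ - d₂ ∈ KZOver.relations k) :
    c₁ * d₁ - c₂ * d₂ ∈ KZOver.relations k := by
  have h := (KZOver.relations k).add_mem (soloInformed_mul_mem_relationsOver_right d₁ hc)
    (soloInformed_mul_mem_relationsOver_left c₂ hd)
  rw [sub_mul, mul_sub] at h
  simpa using h

/-- Equivalent representations have equivalent products: `r ∼ r' → s ∼ s' → r × s ∼ r' × s'`. -/
theorem soloInformed_equivalentOver_prod {m' : ℕ} {r : KZOver.IntegralRep k n}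
    {r' : KZOver.IntegralRep k n'} {s : KZOver.IntegralRep k m} {s' : KZOver.IntegralRep k m'}
    (hr : KZOver.Equivalent r r') (hs : KZOver.Equivalent s s') :
    KZOver.Equivalent (soloInformedProdOver r s) (soloInformedProdOver r' s') := by
  have h := soloInformed_mul_sub_mul_mem_relationsOver hr hs
  rw [soloInformed_ofOver_mul_ofOver, soloInformed_ofOver_mul_ofOver] at h
  exact h

/-! ### The unit `[pt, 1]` and associativity modulo relations -/

/-- **The unit representation `[pt, 1]` over `k`**: domain `ℝ⁰`, integrand `1`, value `1`. -/
def soloInformedUnitOver : KZOver.IntegralRep k 0 where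
  domain := univ
  integrand := fun _ => 1
  isSemialgebraic_domain := isSemialgebraic_univ
  isSemialgebraicFunOn_integrand := by
    simpa using isSemialgebraicFunOn_aeval (isSemialgebraic_univ (k := k) (ι := Fin 0) (R := ℝ))
      (1 : MvPolynomial (Fin 0) k)
  integrableOn := integrableOn_const (hs := by simp [KZ.volume_univ_fin_zero])

/-- The domain of `[pt, 1]`. -/
@[simp] theorem soloInformed_unitOver_domain :
    (soloInformedUnitOver (k := k)).domain = univ := rfl

/-- The integrand of `[pt, 1]`. -/
@[simp] theorem soloInformed_unitOver_integrand :
    (soloInformedUnitOver (k := k)).integrand = fun _ => 1 := rfl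

/-- **`value [pt, 1] = 1`.** -/
@[simp] theorem soloInformed_value_unitOver : (soloInformedUnitOver (k := k)).value = 1 := by
  simp [KZOver.IntegralRep.value, Measure.restrict_univ, measureReal_def, KZ.volume_univ_fin_zero]

section UnitAssoc

variable (r : KZOver.IntegralRep k n) (s : KZOver.IntegralRep k m) (u : KZOver.IntegralRep k l)

/-- **`[pt, 1] × [τ, g]` is a relabelling of `[τ, g]`** along `Fin m ≃ Fin (0 + m)`. -/
theorem soloInformed_unitOver_prodOver_eq_reindex :
    soloInformedProdOver soloInformedUnitOver s =
      soloInformedReindexOver s (finCongr (Nat.zero_add m).symm) := by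
  have hcoord : ∀ (w : Fin (0 + m) → ℝ),
      (fun j => w (Fin.natAdd 0 j)) = fun i => w (finCongr (Nat.zero_add m).symm i) := by
    intro w; funext j; simp
  refine KZOver.IntegralRep.ext ?_ ?_
  · ext w
    simp only [soloInformed_prodOver_domain, soloInformed_mem_prodDomainOver,
      soloInformed_unitOver_domain, mem_univ, true_and, soloInformed_reindexOver_domain,
      mem_setOf_eq, hcoord]
  · funext w
    rw [soloInformed_prodOver_integrand, soloInformed_reindexOver_integrand,
      soloInformed_prodFunOver_apply, soloInformed_unitOver_integrand, one_mul, hcoord]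

/-- **`([σ, f] × [τ, g]) × [υ, h]` is a relabelling of `[σ, f] × ([τ, g] × [υ, h])`** along
`Fin (n + m + l) ≃ Fin (n + (m + l))`: domain `σ × τ × υ`, integrand `f ⊗ g ⊗ h` (`mul_assoc`). -/
theorem soloInformed_prodOver_prodOver_eq_reindex :
    soloInformedProdOver (soloInformedProdOver r s) u =
      soloInformedReindexOver (soloInformedProdOver r (soloInformedProdOver s u))
        (finCongr (Nat.add_assoc n m l).symm) := by
  set e : Fin (n + (m + l)) ≃ Fin (n + m + l) := finCongr (Nat.add_assoc n m l).symm with he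
  have h1 : ∀ (w : Fin (n + m + l) → ℝ),
      (fun i => w (e (Fin.castAdd (m + l) i))) = fun i => w (Fin.castAdd l (Fin.castAdd m i)) := by
    intro w; funext i; congr 1
  have h2 : ∀ (w : Fin (n + m + l) → ℝ),
      (fun i => w (e (Fin.natAdd n (Fin.castAdd l i)))) =
        fun i => w (Fin.castAdd l (Fin.natAdd n i)) := by
    intro w; funext i; congr 1
  have h3 : ∀ (w : Fin (n + m + l) → ℝ),
      (fun j => w (e (Fin.natAdd n (Fin.natAdd m j)))) = fun j => w (Fin.natAdd (n + m) j) := by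
    intro w; funext j; congr 1; exact Fin.ext (Nat.add_assoc _ _ _).symm
  refine KZOver.IntegralRep.ext ?_ ?_
  · ext w
    simp only [soloInformed_prodOver_domain, soloInformed_mem_prodDomainOver,
      soloInformed_reindexOver_domain, mem_setOf_eq]
    rw [h1 w, h2 w, h3 w]
    tauto
  · funext w
    simp only [soloInformed_prodOver_integrand, soloInformed_reindexOver_integrand,
      soloInformed_prodFunOver_apply]
    rw [h1 w, h2 w, h3 w, mul_assoc]

end UnitAssoc

/-- **Left unit modulo relations**: `[pt, 1] * c − c ∈ relations k`. -/
theorem soloInformed_ofUnitOver_mul_sub_mem_relations (c : KZOver.FormalRep k) :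
    KZOver.of soloInformedUnitOver * c - c ∈ KZOver.relations k := by
  refine soloInformed_map_mem_relationsOver_of_forall_of
    (AddMonoidHom.mulLeft (KZOver.of soloInformedUnitOver) - AddMonoidHom.id _) (fun m s => ?_) c
  change KZOver.of soloInformedUnitOver * KZOver.of s - KZOver.of s ∈ KZOver.relations k
  rw [soloInformed_ofOver_mul_ofOver, soloInformed_unitOver_prodOver_eq_reindex, ← neg_sub]
  exact (KZOver.relations k).neg_mem (soloInformed_ofOver_sub_ofOver_reindex_mem_relations _ _)

/-- **Right unit modulo relations**: `c * [pt, 1] − c ∈ relations k`. -/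
theorem soloInformed_mul_ofUnitOver_sub_mem_relations (c : KZOver.FormalRep k) :
    c * KZOver.of soloInformedUnitOver - c ∈ KZOver.relations k := by
  have h := (KZOver.relations k).add_mem
    (soloInformed_mul_sub_mul_comm_mem_relationsOver c (KZOver.of soloInformedUnitOver))
    (soloInformed_ofUnitOver_mul_sub_mem_relations c)
  simpa using h

/-- **Associativity modulo relations, on generators.** -/
theorem soloInformed_ofOver_mul_assoc_sub_mem_relations (r : KZOver.IntegralRep k n)
    (s : KZOver.IntegralRep k m) (u : KZOver.IntegralRep k l) :
    KZOver.of r * KZOver.of s * KZOver.of u - KZOver.of r * (KZOver.of s * KZOver.of u) ∈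
      KZOver.relations k := by
  rw [soloInformed_ofOver_mul_ofOver, soloInformed_ofOver_mul_ofOver, soloInformed_ofOver_mul_ofOver,
    soloInformed_ofOver_mul_ofOver, soloInformed_prodOver_prodOver_eq_reindex, ← neg_sub]
  exact (KZOver.relations k).neg_mem (soloInformed_ofOver_sub_ofOver_reindex_mem_relations _ _)

/-- **Associativity modulo relations**: `(x * y) * z − x * (y * z) ∈ relations k`. -/
theorem soloInformed_mul_assoc_sub_mem_relationsOver (x y z : KZOver.FormalRep k) :
    x * y * z - x * (y * z) ∈ KZOver.relations k := by
  refine soloInformed_map_mem_relationsOver_of_forall_of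
    ((AddMonoidHom.mulRight z).comp (AddMonoidHom.mulRight y) - AddMonoidHom.mulRight (y * z))
    (fun n r => ?_) x
  change KZOver.of r * y * z - KZOver.of r * (y * z) ∈ KZOver.relations k
  refine soloInformed_map_mem_relationsOver_of_forall_of
    ((AddMonoidHom.mulRight z).comp (AddMonoidHom.mulLeft (KZOver.of r)) -
      (AddMonoidHom.mulLeft (KZOver.of r)).comp (AddMonoidHom.mulRight z))
    (fun m s => ?_) y
  change KZOver.of r * KZOver.of s * z - KZOver.of r * (KZOver.of s * z) ∈ KZOver.relations k
  refine soloInformed_map_mem_relationsOver_of_forall_of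
    (AddMonoidHom.mulLeft (KZOver.of r * KZOver.of s) -
      (AddMonoidHom.mulLeft (KZOver.of r)).comp (AddMonoidHom.mulLeft (KZOver.of s)))
    (fun l u => ?_) z
  exact soloInformed_ofOver_mul_assoc_sub_mem_relations r s u

end Summit.KontsevichZagierPeriods.KontsevichZagierPeriods.Theorems
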